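import Summits.Ventures.PercRepro.Night2T3Criterion

/-!
# PercRepro — the coloop count of a rank level set is a size statistic (night-2, NIGHT-2-t3.md §6)

For a rank-`q` set `G ⊆ E` the pairs `(S, x)` with `S ∈ R_q(G)`, `x ∈ S` and `S ∖ x ∈ R_q(G)` (the
non-coloops of `M|S`) are in bijection with the pairs `(S′, x)` with `S′ ∈ R_q(G)` and `x ∈ G ∖ S′`
(`(S, x) ↦ (S ∖ x, x)`, inverse `(S′, x) ↦ (S′ ∪ x, x)`; `S′ ∪ x` has rank `q` because `G` has).  Hence
`Σ_{S ∈ R_q(G)} (|S| − m(S)) = Σ_{S ∈ R_q(G)} |G ∖ S|`, i.e.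
**`Σ_{S ∈ R_q(G)} m(S) = Σ_{S ∈ R_q(G)} (2|S| − |G|)`** (`sum_mTr_eq`): the total number of coloops over the
rank level set is a statistic of the SIZES of its members.  Combined with the `q`-free criterion
(`Jq_three_nonneg_of_count`) this gives the type-`3` balance in the language of level-set sizes alone
(`Jq_three_nonneg_of_sizes`):
`0 ≤ (q + 2)·DF_3 + Σ_{S ∈ R_q(G)} (|G| + q − 3 − 2|S|)  →  0 ≤ J_3`.
Writing `A = G ∖ S` (the coindependent sets of `M|G`, `d = |G| − q`) the hypothesis reads
`Σ_{A coindependent} (d + 3 − 2|A|) ≤ (q + 2)·#{A coindependent : ρ(A) ≤ 2}`.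
Imports `Night2T3Criterion` only.
-/
namespace PercRepro.Star

open Finset ThmH SixFour GenQ

variable {α : Type*} [DecidableEq α] {M : Matroid α} [M.Finite]

/-! ## Coloops of `M|S` are the points whose removal drops the rank -/

/-- A point `x` of a rank-`q` set `S ⊆ E` is a coloop of `M|S` iff `S ∖ x` does not have rank `q`. -/
theorem mem_coloopsOf_iff_eRk_erase_ne {S : Finset α} {q : ℕ} (hS : S ⊆ gr M)
    (hr : M.eRk (S : Set α) = (q : ℕ∞)) {x : α} (hx : x ∈ S) :
    x ∈ coloopsOf M S ↔ M.eRk ((S.erase x : Finset α) : Set α) ≠ (q : ℕ∞) := by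
  rw [mem_coloopsOf]
  constructor
  · rintro ⟨-, hcl⟩ h
    have h1 := eRk_erase_add_one_of_notMem_closure hS hx hcl
    rw [h, hr] at h1
    have h1' : q + 1 = q := by exact_mod_cast h1
    omega
  · intro hne
    refine ⟨hx, fun hcl => hne ?_⟩
    apply le_antisymm
    · rw [← hr]
      exact M.eRk_mono (Finset.coe_subset.2 (Finset.erase_subset x S))
    · rw [← hr, ← M.eRk_closure_eq ((S.erase x : Finset α) : Set α)]
      apply M.eRk_mono
      intro y hy
      by_cases hyx : y = x
      · rw [hyx]
        exact hcl
      · have hyS : y ∈ S := Finset.mem_coe.1 hy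
        have hyE : y ∈ M.E := by
          rw [← coe_gr M]
          exact Finset.mem_coe.2 (hS hyS)
        exact M.mem_closure_of_mem' (Finset.mem_coe.2 (Finset.mem_erase.2 ⟨hyx, hyS⟩)) hyE

/-- `|S| − m(S)` is the number of points of the rank-`q` set `S` whose removal keeps the rank `q`. -/
theorem card_filter_eRk_erase_eq {S : Finset α} {q : ℕ} (hS : S ⊆ gr M)
    (hr : M.eRk (S : Set α) = (q : ℕ∞)) :
    (S.filter (fun x => M.eRk ((S.erase x : Finset α) : Set α) = (q : ℕ∞))).card = S.card - mTr M S := by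
  unfold mTr
  have hcol : coloopsOf M S =
      S.filter (fun x => ¬ M.eRk ((S.erase x : Finset α) : Set α) = (q : ℕ∞)) := by
    ext x
    rw [Finset.mem_filter]
    constructor
    · intro h
      have hx := coloopsOf_subset S h
      exact ⟨hx, (mem_coloopsOf_iff_eRk_erase_ne hS hr hx).1 h⟩
    · rintro ⟨hx, hne⟩
      exact (mem_coloopsOf_iff_eRk_erase_ne hS hr hx).2 hne
  have h := Finset.card_filter_add_card_filter_not (s := S)
    (fun x => M.eRk ((S.erase x : Finset α) : Set α) = (q : ℕ∞))
  rw [hcol]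
  omega

/-! ## The double counting -/

/-- For a point `x ∈ G` of a rank-`q` set `G`, the sets `S ∈ R_q(G)` with `x ∈ S` and `S ∖ x ∈ R_q(G)` are in
bijection with the sets `S′ ∈ R_q(G)` avoiding `x` (`S ↦ S ∖ x`, `S′ ↦ S′ ∪ x`). -/
theorem card_filter_erase_eq_card_filter_notMem {G : Finset α} {q : ℕ}
    (hrG : M.eRk (G : Set α) = (q : ℕ∞)) {x : α} (hxG : x ∈ G) :
    ((Rq M G q).filter (fun S : Finset α =>
        x ∈ S ∧ M.eRk ((S.erase x : Finset α) : Set α) = (q : ℕ∞))).card =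
      ((Rq M G q).filter (fun S : Finset α => x ∉ S)).card := by
  refine Finset.card_bij' (fun S _ => S.erase x) (fun S _ => insert x S) ?hi ?hj ?li ?ri
  case hi =>
    intro S hS
    rw [Finset.mem_filter, mem_Rq] at hS ⊢
    exact ⟨⟨(Finset.erase_subset x S).trans hS.1.1, hS.2.2⟩, Finset.notMem_erase x S⟩
  case hj =>
    intro S hS
    rw [Finset.mem_filter, mem_Rq] at hS ⊢
    have hsub : insert x S ⊆ G := Finset.insert_subset hxG hS.1.1
    have hr : M.eRk ((insert x S : Finset α) : Set α) = (q : ℕ∞) := by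
      apply le_antisymm
      · rw [← hrG]
        exact M.eRk_mono (Finset.coe_subset.2 hsub)
      · rw [← hS.1.2]
        exact M.eRk_mono (Finset.coe_subset.2 (Finset.subset_insert x S))
    refine ⟨⟨hsub, hr⟩, Finset.mem_insert_self x S, ?_⟩
    rw [Finset.erase_insert hS.2]
    exact hS.1.2
  case li =>
    intro S hS
    have hS' := Finset.mem_filter.1 hS
    exact Finset.insert_erase hS'.2.1
  case ri =>
    intro S hS
    have hS' := Finset.mem_filter.1 hS
    exact Finset.erase_insert hS'.2

/-- **Double counting**: `Σ_{S ∈ R_q(G)} (|S| − m(S)) = Σ_{S ∈ R_q(G)} |G ∖ S|` on a rank-`q` set `G ⊆ E`. -/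
theorem sum_card_sub_mTr_eq_sum_card_sdiff {G : Finset α} {q : ℕ} (hG : G ⊆ gr M)
    (hrG : M.eRk (G : Set α) = (q : ℕ∞)) :
    ∑ S ∈ Rq M G q, ((S.card : ℤ) - (mTr M S : ℤ)) = ∑ S ∈ Rq M G q, ((G \ S).card : ℤ) := by
  have hL : ∀ S ∈ Rq M G q, ((S.card : ℤ) - (mTr M S : ℤ)) =
      ∑ y ∈ G, (if (y ∈ S ∧ M.eRk ((S.erase y : Finset α) : Set α) = (q : ℕ∞)) then (1 : ℤ) else 0) := by
    intro S hS
    have hS' := mem_Rq.1 hS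
    have hc := card_filter_eRk_erase_eq (hS'.1.trans hG) hS'.2
    have hm : mTr M S ≤ S.card := Finset.card_le_card (coloopsOf_subset S)
    rw [Finset.sum_boole]
    have hfilt : G.filter (fun y => y ∈ S ∧ M.eRk ((S.erase y : Finset α) : Set α) = (q : ℕ∞)) =
        S.filter (fun y => M.eRk ((S.erase y : Finset α) : Set α) = (q : ℕ∞)) := by
      ext y
      simp only [Finset.mem_filter]
      constructor
      · rintro ⟨-, hyS, h⟩
        exact ⟨hyS, h⟩
      · rintro ⟨hyS, h⟩
        exact ⟨hS'.1 hyS, hyS, h⟩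
    rw [hfilt, hc]
    push_cast [hm]
    ring
  have hR : ∀ S ∈ Rq M G q, ((G \ S).card : ℤ) = ∑ y ∈ G, (if y ∉ S then (1 : ℤ) else 0) := by
    intro S _
    rw [Finset.sum_boole, Finset.sdiff_eq_filter]
  rw [Finset.sum_congr rfl hL, Finset.sum_congr rfl hR, Finset.sum_comm]
  conv_rhs => rw [Finset.sum_comm]
  apply Finset.sum_congr rfl
  intro y hy
  rw [Finset.sum_boole, Finset.sum_boole, card_filter_erase_eq_card_filter_notMem hrG hy]

/-- **The coloop count is a size statistic**: `Σ_{S ∈ R_q(G)} m(S) = Σ_{S ∈ R_q(G)} (2|S| − |G|)`. -/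
theorem sum_mTr_eq {G : Finset α} {q : ℕ} (hG : G ⊆ gr M) (hrG : M.eRk (G : Set α) = (q : ℕ∞)) :
    ∑ S ∈ Rq M G q, (mTr M S : ℤ) = ∑ S ∈ Rq M G q, (2 * (S.card : ℤ) - (G.card : ℤ)) := by
  have h := sum_card_sub_mTr_eq_sum_card_sdiff hG hrG
  have hsd : ∀ S ∈ Rq M G q, ((G \ S).card : ℤ) = (G.card : ℤ) - (S.card : ℤ) := by
    intro S hS
    have hS' := (mem_Rq.1 hS).1
    rw [Finset.card_sdiff_of_subset hS']
    push_cast [Finset.card_le_card hS']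
    ring
  rw [Finset.sum_congr rfl hsd, Finset.sum_sub_distrib] at h
  rw [Finset.sum_sub_distrib] at h
  have h2 : ∑ S ∈ Rq M G q, (2 * (S.card : ℤ) - (G.card : ℤ)) =
      2 * ∑ S ∈ Rq M G q, (S.card : ℤ) - ∑ S ∈ Rq M G q, (G.card : ℤ) := by
    rw [Finset.sum_sub_distrib, Finset.mul_sum]
  rw [h2]
  linarith

/-! ## The type-`3` balance in the language of sizes -/

/-- On a basis `m(B) = q`. -/
theorem mTr_eq_of_mem_Bq {G B : Finset α} {q : ℕ} (hB : B ∈ Bq M G q) : mTr M B = q := by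
  have hB' := mem_Bq.1 hB
  unfold mTr
  rw [coloopsOf_eq_self_of_indep (indep_of_eRk_eq_of_card_eq hB'.2.1 hB'.2.2), hB'.2.2]

/-- `Σ_{S ∈ R_q(G)} (q − 3 − m(S)) = −3·#𝓑 + Σ_{S spanning non-basis} (q − 3 − m(S))`. -/
theorem sum_Rq_q_sub_mTr_eq (G : Finset α) (q : ℕ) :
    ∑ S ∈ Rq M G q, ((q : ℚ) - 3 - (mTr M S : ℚ)) =
      -3 * ((Bq M G q).card : ℚ) + ∑ S ∈ SNq M G q, ((q : ℚ) - 3 - (mTr M S : ℚ)) := by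
  rw [sum_Rq_eq_sum_Bq_add_sum_SNq]
  have hB : ∀ B ∈ Bq M G q, ((q : ℚ) - 3 - (mTr M B : ℚ)) = -3 := by
    intro B hB
    rw [mTr_eq_of_mem_Bq hB]
    ring
  rw [Finset.sum_congr rfl hB, Finset.sum_const, nsmul_eq_mul]
  ring

/-- **The type-`3` balance from level-set sizes alone** (Corollary A3 in size form): on a simple matroid, if
`0 ≤ (q + 2)·DF_3 + Σ_{S ∈ R_q(G)} (|G| + q − 3 − 2|S|)` then `0 ≤ J_3(G)`. -/
theorem Jq_three_nonneg_of_sizes (hs : Simple M) {G : Finset α} {q : ℕ} (hG : G ⊆ gr M)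
    (hrG : M.eRk (G : Set α) = (q : ℕ∞)) (hq : 1 ≤ q)
    (h : 0 ≤ ((q : ℚ) + 2) * (DFq M G q 3 : ℚ) +
      ∑ S ∈ Rq M G q, ((G.card : ℚ) + (q : ℚ) - 3 - 2 * (S.card : ℚ))) :
    0 ≤ Jq M G q 3 := by
  apply Jq_three_nonneg_of_count hs hG hq
  have hsum : ∑ S ∈ Rq M G q, ((q : ℚ) - 3 - (mTr M S : ℚ)) =
      ∑ S ∈ Rq M G q, ((G.card : ℚ) + (q : ℚ) - 3 - 2 * (S.card : ℚ)) := by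
    have hm := sum_mTr_eq hG hrG
    have hm' : ∑ S ∈ Rq M G q, (mTr M S : ℚ) = ∑ S ∈ Rq M G q, (2 * (S.card : ℚ) - (G.card : ℚ)) := by
      have := congrArg (fun z : ℤ => (z : ℚ)) hm
      push_cast at this
      exact this
    have e1 : ∑ S ∈ Rq M G q, ((q : ℚ) - 3 - (mTr M S : ℚ)) =
        ∑ S ∈ Rq M G q, ((q : ℚ) - 3) - ∑ S ∈ Rq M G q, (mTr M S : ℚ) := Finset.sum_sub_distrib _ _
    have e2 : ∑ S ∈ Rq M G q, ((G.card : ℚ) + (q : ℚ) - 3 - 2 * (S.card : ℚ)) =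
        ∑ S ∈ Rq M G q, ((q : ℚ) - 3) - ∑ S ∈ Rq M G q, (2 * (S.card : ℚ) - (G.card : ℚ)) := by
      rw [← Finset.sum_sub_distrib]
      apply Finset.sum_congr rfl
      intro S _
      ring
    rw [e1, e2, hm']
  rw [sum_Rq_q_sub_mTr_eq] at hsum
  linarith

end PercRepro.Star
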